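import Summits.CriticalPhenomena.Ising3D.ExclusionSentencesTrgGamma

/-!
# Exclusion sentences — 2D control `Δ_ε = 1` vs the FULL `TRG` table one rung later (`10⁻⁶`), part 1 of 2
(cell `pub-ising3x`, seat recog-1, gen 6)

HONEST FRAMING: lottery ticket; floor = tightest certified 3D Ising CFT bounds; no exact-solution
claim without a proof.

Rule R3 (survive the next certified digit) in kernel form for `Δ_ε`: within `10⁻⁵` of `1` the whole FAMILIES-v1
family `TRG` (`D ≤ 17`, `h ≤ 32`, with the `Γ(¼)`/`Γ(⅓)` powers) has exactly five members
(`control_eps_trgFull`, `ExclusionSentencesControl2DTrgGammaEpsFin.lean`); within `10⁻⁶` it has NONE — the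
exception list is EMPTY (Python twin `tools/trg_gamma_exceptions.py`: none within `10⁻⁶`, none within `10⁻⁷`).
The width `10⁻⁶` matches `control_eps_trg_lin` (LIN `H ≤ 12` empties at `10⁻⁶`).  This file: parts `0–3`;
`ExclusionSentencesControl2DTrgGammaEps6Fin.lean`: parts `4–7`, the assembled sentence and the printed shape, used
by the catalogue-wide recognition theorem of `ExclusionSentencesControl2DRecognised.lean`.
No 3D digit is used anywhere.
-/

namespace Summit.CriticalPhenomena.Ising3D

/-- Part 0 (classes `Γ(¼)^{−4}`, `Γ(¼)^{−3}`) of the full-TRG sentence on `[1 − 10⁻⁶, 1 + 10⁻⁶]`, empty list. -/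
theorem trgFull_control_eps6_p0 :
    trgFullPart 17 32 0 (1 - 1 / 10 ^ 6) (1 + 1 / 10 ^ 6) [] = true := by
  decide +kernel

/-- Part 1 (classes `Γ(¼)^{−2}`, `Γ(¼)^{−1}`). -/
theorem trgFull_control_eps6_p1 :
    trgFullPart 17 32 1 (1 - 1 / 10 ^ 6) (1 + 1 / 10 ^ 6) [] = true := by
  decide +kernel

/-- Part 2 (classes `Γ`-free, `Γ(¼)¹`). -/
theorem trgFull_control_eps6_p2 :
    trgFullPart 17 32 2 (1 - 1 / 10 ^ 6) (1 + 1 / 10 ^ 6) [] = true := by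
  decide +kernel

/-- Part 3 (classes `Γ(¼)²`, `Γ(¼)³`). -/
theorem trgFull_control_eps6_p3 :
    trgFullPart 17 32 3 (1 - 1 / 10 ^ 6) (1 + 1 / 10 ^ 6) [] = true := by
  decide +kernel

end Summit.CriticalPhenomena.Ising3D
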